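/-
Copyright (c) 2026 the pub-hodgecm-mathlib formalisation cell (harness21).  Prover seat hodgecm-mathlib-K2Liu-p03 (g8), Track B «K2-LIT»,
#184♮ = hLiu418 = `stmt-HodgeConjecture-24832`; socket #41, KIND 1 — (K1a-T)(L2-dock)(v-α) THE TWO ARCHIMEDEAN PRODUCT LETTERS OF THE PREFACTOR DICTIONARY:
a lattice element is archimedeanly small at one complex place only at the expense of the others (`∏_w w(y)⁻¹ ≤ n^{[L:ℚ]}` for `n·y` integral), and the
normalised row of a rank-one lattice index has `∏_w Σ_k ‖ι_w(w_k∕w_i)‖² ≤ 2^{#w}·(D(1+τ))^{[L:ℚ]}` (K1a desk K2Liu-p01 (g11) WORD #10∕#14; K2E4-p10 (g10) HANDOFF «(v) is p03's»).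
THEOREMS ONLY (no `def`, no `instance`, no notation, no named-fact hypothesis, no `sorry`).
-/
import Summits.HodgeConjecture.HodgeConjecture.Theorems.K2LiuRankOneLineProjectiveHeight        -- ★ (ρ6b) `mulHeight_le_of_vecMulVec_integral`
import Summits.HodgeConjecture.HodgeConjecture.Theorems.K2LiuSiegelEisensteinKindWFinitePlaces    -- ★ FILE 2c `prod_pow_absNorm_le_abs_norm_of_valuation_le` (`1 ≤ |N(z)|` at `T = ∅`)
import Mathlib.NumberTheory.NumberField.CMField
import HarnessLib

/-!
# Crux `HLiu418`, socket #41, KIND 1 a♮ — (K1a-T)(L2-dock)(v-α) `K2LiuKindOneSingularArchProducts`: THE ARCHIMEDEAN PRODUCT LETTERS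

Cell `hodgecm-mathlib`, crux item hLiu418 = `stmt-HodgeConjecture-24832` (helper lane `--supports … --as helper`, count-neutral), route of record `HCCMUnconditional`;
squad K2 ∕ K2Liu, road `K2_Liu`, socket #41, KIND 1, block K1-a♮.  CONSUMER: this seat's (v) `hP_of_cornerReading` (★ p864498's prefactor slot (v): the per-place sizes
`Sz_w = ((1+P_w)(1+P_w⁻¹))((1+t_w)(1+t_w⁻¹))(1+R_w)` of (iv) have NO `X`-uniform bound at a single place — `t_w⁻¹ = (κ_w·w(σc X))⁻¹`, `P_w ∝ ‖ι_w γ̂₁‖²` — only their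
PRODUCTS over the complex places are lattice-controlled; these are the two product letters).
* `mult_eq_two` — a CM field is totally complex: every infinite place has `mult = 2`.
* **`prod_inv_apply_le_pow_of_isIntegral`** — for `y ≠ 0` with `n·y` integral over `ℤ` (`n ≥ 1`): `∏_w w(y)⁻¹ ≤ n^{[L:ℚ]}` (product formula as an inequality:
  `∏_w (n·w(y))² = |N_{L∕ℚ}(n y)| ≥ 1`, ★ FILE 2c at `T = ∅` + Mathlib `InfinitePlace.prod_eq_abs_norm`).
* **`prod_sum_sq_normalisedRow_le`** — for a rank-one `u ⊗ w ≠ 0` with `D·(u ⊗ w)` integral and a pivot `w_i ≠ 0`: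
  `∏_w Σ_k ‖ι_w(w_i⁻¹ w_k)‖² ≤ 2^{#places}·(D·(1 + ‖ι_∞(u ⊗ w)‖))^{[L:ℚ]}` (`Σ_k ≤ 2·(max_k)²`, `∏_w max² = ` archimedean part of `H(w_i⁻¹•w) = H(w)` since the finite part
  is `≥ 1` at the coordinate `1` — Mathlib `NumberField.mulHeight_eq`, `Height.mulHeight_smul_eq_mulHeight` —, ★ (ρ6b) `mulHeight_le_of_vecMulVec_integral`).
HONEST LABEL.  Count-neutral helper; it closes no socket: `HC_CM` is proved only modulo the 7 printed citations (2 remaining named inputs: hLiu418 =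
`stmt-HodgeConjecture-24832`, h413 = `stmt-HodgeConjecture-24833`) until rung 0 closes.

## References
* [NeukirchANT1999] J. Neukirch, *Algebraic Number Theory* (1999): Ch. I §5, Ch. III §1 (product formula).
* [BombieriGubler2006] E. Bombieri, W. Gubler, *Heights in Diophantine Geometry* (2006): §1.5.
* [KudlaRallis1994] S. Kudla, S. Rallis, *A regularized Siegel–Weil formula: the first term identity*, Ann. of Math. 140 (1994): §2.
-/

set_option autoImplicit false
-- the mandated namespace repeats the single-problem summit's segment (`HodgeConjecture.HodgeConjecture`)
set_option linter.dupNamespace false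

noncomputable section

open scoped Matrix
open NumberField NumberField.InfinitePlace Height

namespace Summit.HodgeConjecture.HodgeConjecture.Cruxes.HLiu418.K2LiuKindOneSingularArchProducts

open Summit.HodgeConjecture.HodgeConjecture.Cruxes.HLiu418.K2LiuRankOneLineProjectiveHeight (mulHeight_le_of_vecMulVec_integral)
open Summit.HodgeConjecture.HodgeConjecture.Cruxes.HLiu418.K2LiuSiegelEisensteinKindWFinitePlaces (prod_pow_absNorm_le_abs_norm_of_valuation_le)

variable (L : Type) [Field L] [NumberField L] [IsCMField L]

/-- a CM field is totally complex: every infinite place is complex, `mult w = 2`. [cite: NeukirchANT1999, Ch. I §5] -/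
theorem mult_eq_two (w : InfinitePlace L) : w.mult = 2 :=
  mult_isComplex ⟨w, IsTotallyComplex.isComplex w⟩

/-- **`∏_w w(y)⁻¹ ≤ n^{[L:ℚ]}`** for `y ≠ 0` with `n·y` integral over `ℤ`, `n ≥ 1`: a lattice element cannot be archimedeanly small at all complex places at once
(`∏_w (n·w(y))^2 = |N_{L∕ℚ}(n·y)| ≥ 1`). [cite: NeukirchANT1999, Ch. III §1] -/
theorem prod_inv_apply_le_pow_of_isIntegral (y : L) (hy0 : y ≠ 0) {n : ℕ} (hn : n ≠ 0) (hint : IsIntegral ℤ ((n : L) * y)) :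
    ∏ w : InfinitePlace L, (w y)⁻¹ ≤ (n : ℝ) ^ Module.finrank ℚ L := by
  have hz0 : (n : L) * y ≠ 0 := mul_ne_zero (by exact_mod_cast hn) hy0
  -- `1 ≤ |N(n·y)|` (★ FILE 2c at `T = ∅`)
  have h1 : (1 : ℝ) ≤ |((Algebra.norm ℚ ((n : L) * y) : ℚ) : ℝ)| := by
    have h := prod_pow_absNorm_le_abs_norm_of_valuation_le L ((n : L) * y) hz0 hint ∅ (fun _ => 0) (fun _ h => absurd h (Finset.notMem_empty _))
    rwa [Finset.prod_empty] at h
  -- `|N(n·y)| = ∏_w (n·w(y))^2 = n^{[L:ℚ]}·(∏_w w(y))^2`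
  have hprod : |((Algebra.norm ℚ ((n : L) * y) : ℚ) : ℝ)| = (n : ℝ) ^ Module.finrank ℚ L * (∏ w : InfinitePlace L, w y) ^ 2 := by
    rw [← Rat.cast_abs, ← prod_eq_abs_norm ((n : L) * y), ← sum_mult_eq (K := L), ← Finset.prod_pow_eq_pow_sum, ← Finset.prod_pow, ← Finset.prod_mul_distrib]
    refine Finset.prod_congr rfl fun w _ => ?_
    rw [mult_eq_two, map_mul, ← InfinitePlace.norm_embedding_eq w (n : L), map_natCast, Complex.norm_natCast]
    ring
  have hP0 : 0 < ∏ w : InfinitePlace L, w y := Finset.prod_pos fun w _ => InfinitePlace.pos_iff.2 hy0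
  have hn1 : (1 : ℝ) ≤ (n : ℝ) ^ Module.finrank ℚ L := one_le_pow₀ (by exact_mod_cast Nat.one_le_iff_ne_zero.2 hn)
  rw [hprod] at h1
  rw [Finset.prod_inv_distrib, inv_le_iff_one_le_mul₀ hP0]
  -- `Q := n^{[L:ℚ]}·∏ w(y)` has `Q² ≥ n^{[L:ℚ]} ≥ 1` and `Q ≥ 0`
  nlinarith [mul_nonneg (zero_le_one.trans hn1) hP0.le, mul_le_mul_of_nonneg_left h1 (zero_le_one.trans hn1)]

open Classical in -- the archimedean size `‖(ι_∞ S_ab)_ab‖` is read with the consumers' instances (★ (ρ6b), ★ p864498: `open Classical in`)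
/-- **`∏_w Σ_k ‖ι_w(w_i⁻¹·w_k)‖² ≤ 2^{#places}·(D·(1+‖ι_∞(u ⊗ w)‖))^{[L:ℚ]}`** for a rank-one index `u ⊗ w ≠ 0` with `D·(u ⊗ w)` integral over `ℤ` (`D ≥ 1`) and a pivot
`w_i ≠ 0`: per place `Σ_k ≤ 2·(max_k)^2 = 2·(max_k)^{mult}`, the product of the maxima is the archimedean part of `H(w_i⁻¹•w) = H(w)` (finite part `≥ 1` at the coordinate
`w_i⁻¹ w_i = 1`), and ★ (ρ6b) bounds `H(w)`. [cite: BombieriGubler2006, §1.5] [cite: KudlaRallis1994, §2] -/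
theorem prod_sum_sq_normalisedRow_le {m : Type*} [Fintype m] (u : m → L) (w : Fin 2 → L) (hS : Matrix.vecMulVec u w ≠ 0)
    {D : ℕ} (hD : 1 ≤ D) (hint : ∀ a b, IsIntegral ℤ ((D : L) * Matrix.vecMulVec u w a b)) {i : Fin 2} (hi : w i ≠ 0) :
    ∏ w' : InfinitePlace L, (∑ k, ‖w'.embedding ((w i)⁻¹ * w k)‖ ^ 2) ≤
      (2 : ℝ) ^ Fintype.card (InfinitePlace L) * ((D : ℝ) * (1 + ‖fun a b => mixedEmbedding L (Matrix.vecMulVec u w a b)‖)) ^ Module.finrank ℚ L := by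
  set v : Fin 2 → L := (w i)⁻¹ • w with hvdef
  have hvk : ∀ k, (w i)⁻¹ * w k = v k := fun k => by rw [hvdef, Pi.smul_apply, smul_eq_mul]
  have hvi : v i = 1 := by rw [← hvk, inv_mul_cancel₀ hi]
  have hv0 : v ≠ 0 := fun h0 => one_ne_zero (by rw [← hvi, h0, Pi.zero_apply])
  -- per place: `Σ_k ‖ι v_k‖² ≤ 2·(⨆_k w'(v_k))^{mult w'}`
  have hbdd : ∀ w' : InfinitePlace L, BddAbove (Set.range fun k => w' (v k)) := fun w' => Finite.bddAbove_range _
  have hplace : ∀ w' : InfinitePlace L, ∑ k, ‖w'.embedding ((w i)⁻¹ * w k)‖ ^ 2 ≤ 2 * (⨆ k, w' (v k)) ^ w'.mult := by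
    intro w'
    rw [mult_eq_two, Fin.sum_univ_two, hvk, hvk, InfinitePlace.norm_embedding_eq, InfinitePlace.norm_embedding_eq]
    have h0 := le_ciSup (hbdd w') 0
    have h1 := le_ciSup (hbdd w') 1
    have h0' := apply_nonneg w' (v 0)
    have h1' := apply_nonneg w' (v 1)
    nlinarith
  -- the archimedean part of the height of `v`, the finite part being `≥ 1`
  have hfin : (1 : ℝ) ≤ ∏ᶠ p : FinitePlace L, ⨆ k, p (v k) := one_le_finprod fun p =>
    le_ciSup_of_le (Finite.bddAbove_range _) i (by rw [hvi, map_one])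
  have harch0 : 0 ≤ ∏ w' : InfinitePlace L, (⨆ k, w' (v k)) ^ w'.mult :=
    Finset.prod_nonneg fun w' _ => pow_nonneg ((apply_nonneg w' (v i)).trans (le_ciSup (hbdd w') i)) _
  have harch : ∏ w' : InfinitePlace L, (⨆ k, w' (v k)) ^ w'.mult ≤ mulHeight v := by
    rw [NumberField.mulHeight_eq hv0]
    exact le_mul_of_one_le_right harch0 hfin
  -- `H(v) = H(w) ≤ (D(1+τ))^{[L:ℚ]}`
  have hH : mulHeight v ≤ ((D : ℝ) * (1 + ‖fun a b => mixedEmbedding L (Matrix.vecMulVec u w a b)‖)) ^ Module.finrank ℚ L := by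
    rw [hvdef, mulHeight_smul_eq_mulHeight _ (inv_ne_zero hi)]
    exact mulHeight_le_of_vecMulVec_integral L u w hS hD hint
  calc ∏ w' : InfinitePlace L, (∑ k, ‖w'.embedding ((w i)⁻¹ * w k)‖ ^ 2)
      ≤ ∏ w' : InfinitePlace L, 2 * (⨆ k, w' (v k)) ^ w'.mult :=
        Finset.prod_le_prod (fun w' _ => Finset.sum_nonneg fun k _ => sq_nonneg _) fun w' _ => hplace w'
    _ = (2 : ℝ) ^ Fintype.card (InfinitePlace L) * ∏ w' : InfinitePlace L, (⨆ k, w' (v k)) ^ w'.mult := by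
        rw [Finset.prod_mul_distrib, Finset.prod_const, Finset.card_univ]
    _ ≤ (2 : ℝ) ^ Fintype.card (InfinitePlace L) * ((D : ℝ) * (1 + ‖fun a b => mixedEmbedding L (Matrix.vecMulVec u w a b)‖)) ^ Module.finrank ℚ L :=
        mul_le_mul_of_nonneg_left (harch.trans hH) (by positivity)

end Summit.HodgeConjecture.HodgeConjecture.Cruxes.HLiu418.K2LiuKindOneSingularArchProducts

end
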